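import Summits.KontsevichZagierPeriods.Zeta5Search.Barrier.ConeGammaCuspSlopeLexGerm

/-!
# ζ(5) search — BARRIER: THE KINK OF THE CUSP SLOPE AT A SIMPLE TIE IS THE POOLED WALL DEFECT — the two lexicographic chambers at
# a displacement with ONE tie differ by one adjacent transposition (file (2) of «THE LEXICOGRAPHIC GERM»)

HONEST FRAMING (cell `pub-zeta5`): systematic search; no irrationality claim unless kernel-certified. MODEL objects
under Brown–Zudilin's (28)+(30) accounting ([BZ22] = arXiv:2210.03391; (28) observed, not proved); nothing here is a
statement about `ζ(5)`, any `γ` of record, the cone's supremum (C2 OPEN) or the value / sign of the cusp slope, of a wall defect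
or of a junction count at a named direction (DATA of the cell: P2 g31's desk found pooled wall defects of both signs at every named
direction); NO cancellation is quantified; S-E / (TD_A) stay CONJECTURED; records in print UNMOVED. Prover P2 g42 (item «THE
LEXICOGRAPHIC GERM», file (2); plan INBOX 2026-08-28). Sources: file (1) `ConeGammaCuspSlopeLexGerm` (the lexicographic germ and the
kink of `σ` at any displacement), P2 g30 `ConeGammaCuspGermKink` (`greedy_sub_greedy_of_adjacent`: two reference orders differing by
ONE adjacent transposition have greedy functionals differing by the local modularity defect times the splitting), P2 g33
`ConeGammaCuspPeriodCanonical` (`canonical_defect_abs_le_junctionCount`: every wall defect of the canonical `F` is bounded by the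
number of junctions of the period on the wall).

SETTING. `a` with all 28 forms positive, `T > 0` a period, `σ = cuspSlope a T`, `F` the canonical period pattern function, rates
`r_k(θ) = φ_k(θ)/h_k(a)`. A displacement `δ` has a SIMPLE TIE at `{k₁, k₂}` if `r_{k₁}(δ) = r_{k₂}(δ)` and every other pair of
rates of `δ` is distinct (a generic point of ONE wall of the rate arrangement); `Δ` SPLITS the tie if `r_{k₁}(Δ) < r_{k₂}(Δ)`;
`S = {j : r_{k₁}(δ) < r_j(δ)}` is the set of forms above the tie and
`m_F = F(S∪{k₁}) + F(S∪{k₂}) − F(S) − F(S∪{k₁,k₂})` the POOLED WALL DEFECT of `F` behind `S` at `{k₁, k₂}` (P2 g31: the sum over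
the junctions of the period where both `k₁` and `k₂` are members of the local defects of the junction pattern functions).
* `lex_functional_sub_of_simple_tie` — the lexicographic references `δ₀⁺` of `(δ, Δ)` and `δ₀⁻` of `(δ, −Δ)` differ by ONE ADJACENT
  TRANSPOSITION (`k₁ k₂` versus `k₂ k₁`, every other form on the same side for both, same relative order elsewhere), so
  `Σ_k (W_k(δ₀⁺) − W_k(δ₀⁻))·x_k = m_F·(x_{k₂} − x_{k₁})` for every `x`;
* **`cuspSlope_symm_add_smul_eq_of_simple_tie` — THE KINK OF `σ` AT A SIMPLE TIE IS THE POOLED DEFECT TIMES THE SPLITTING**: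
  `σ(δ + t·Δ) + σ(δ − t·Δ) − 2σ(δ) = t·m_F·(r_{k₂}(Δ) − r_{k₁}(Δ))` on `[0, t₀]`;
* `canonical_value_int` (the canonical `F` is integer-valued), **`cuspSlope_kink_of_simple_tie`** — REFERENCE-FREE: for every `δ`
  with a simple tie at `{k₁,k₂}` and every splitting `Δ` the kink is `t·m·(r_{k₂}(Δ) − r_{k₁}(Δ))` with an INTEGER `m = m_F`,
  **`|m| ≤ #{junctions b of the period with b·h_{k₁}(a), b·h_{k₂}(a) ∈ ℤ}`** (P2 g32/g33's junction count of the wall).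
READING (for file (3)): near the closed orbit the translate integral `P` equals `P(0) + σ`, so THIS is the kink of `P` across a rate
wall inside the coherence ball — an integer multiple `m` of the wall covector with `|m|` up to the junction count, NOT a unit: at a
rate wall `ρ_{k₁} = ρ_{k₂}` of a coherent translate the crossings of `k₁` and `k₂` swap SIMULTANEOUSLY at every common junction of the
period (P2 g41's unit-kink theorem `jumpMass_sub_of_swap` is the case of ONE swapped pair, away from the coherence ball).
NOT here (honest): the value or sign of any `m_F` (DATA); ties of higher multiplicity (several coincident pairs: the two lexicographic
references then differ by a longer permutation); `Φ`, `γ`, C2, S-E's truth, `ζ(5)`.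
-/

noncomputable section

open Set Finset Filter
open scoped Topology

namespace Summit.KontsevichZagierPeriods.Zeta5Search.Barrier.ConeGamma

/-! ### At a simple tie the two lexicographic references are adjacent-transposed -/

/-- **THE TWO LEXICOGRAPHIC FUNCTIONALS AT A SIMPLE TIE DIFFER BY THE POOLED WALL DEFECT.** Let `δ` have a simple tie at
`{k₁, k₂}` (`k₁ ≠ k₂`, `r_{k₁}(δ) = r_{k₂}(δ)`, all other pairs of rates of `δ` distinct), let `Δ` split it (`r_{k₁}(Δ) < r_{k₂}(Δ)`),
and let `δ₀`, `δ₀'` be generic references refining the lexicographic orders of `(δ, Δ)` and `(δ, −Δ)` (the latter: ties broken by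
the reversed order of the rates of `Δ`). Then for every `x : Fin 28 → ℝ`, with `S = {j : r_{k₁}(δ) < r_j(δ)}`:
`Σ_k (W_k(δ₀) − W_k(δ₀'))·x_k = (F(S∪{k₁}) + F(S∪{k₂}) − F(S) − F(S∪{k₁,k₂}))·(x_{k₂} − x_{k₁})`. -/
theorem lex_functional_sub_of_simple_tie {a : Dir} (F : Finset (Fin 28) → ℝ) (δ Δ : Fin 8 → ℝ) {k₁ k₂ : Fin 28}
    (hne : k₁ ≠ k₂) (htie : phiForm δ k₁ / h28 a k₁ = phiForm δ k₂ / h28 a k₂)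
    (hsimple : ∀ i j : Fin 28, i ≠ j → phiForm δ i / h28 a i = phiForm δ j / h28 a j →
      (i = k₁ ∧ j = k₂) ∨ (i = k₂ ∧ j = k₁))
    (hsplit : phiForm Δ k₁ / h28 a k₁ < phiForm Δ k₂ / h28 a k₂) {δ₀ δ₀' : Fin 8 → ℝ}
    (hgen : ∀ k l : Fin 28, k ≠ l → phiForm δ₀ k / h28 a k ≠ phiForm δ₀ l / h28 a l)
    (hgen' : ∀ k l : Fin 28, k ≠ l → phiForm δ₀' k / h28 a k ≠ phiForm δ₀' l / h28 a l)
    (hlex : ∀ k l : Fin 28, (phiForm δ k / h28 a k < phiForm δ l / h28 a l ∨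
        (phiForm δ k / h28 a k = phiForm δ l / h28 a l ∧ phiForm Δ k / h28 a k < phiForm Δ l / h28 a l)) →
      phiForm δ₀ k / h28 a k < phiForm δ₀ l / h28 a l)
    (hlex' : ∀ k l : Fin 28, (phiForm δ k / h28 a k < phiForm δ l / h28 a l ∨
        (phiForm δ k / h28 a k = phiForm δ l / h28 a l ∧ phiForm Δ l / h28 a l < phiForm Δ k / h28 a k)) →
      phiForm δ₀' k / h28 a k < phiForm δ₀' l / h28 a l)
    (x : Fin 28 → ℝ) :
    ∑ k, ((F (Finset.univ.filter fun l => phiForm δ₀ k / h28 a k ≤ phiForm δ₀ l / h28 a l) -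
          F (Finset.univ.filter fun l => phiForm δ₀ k / h28 a k < phiForm δ₀ l / h28 a l)) -
        (F (Finset.univ.filter fun l => phiForm δ₀' k / h28 a k ≤ phiForm δ₀' l / h28 a l) -
          F (Finset.univ.filter fun l => phiForm δ₀' k / h28 a k < phiForm δ₀' l / h28 a l))) * x k =
      (F (insert k₁ (Finset.univ.filter fun j => phiForm δ k₁ / h28 a k₁ < phiForm δ j / h28 a j)) +
          F (insert k₂ (Finset.univ.filter fun j => phiForm δ k₁ / h28 a k₁ < phiForm δ j / h28 a j)) -
          F (Finset.univ.filter fun j => phiForm δ k₁ / h28 a k₁ < phiForm δ j / h28 a j) -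
          F (insert k₁ (insert k₂ (Finset.univ.filter fun j => phiForm δ k₁ / h28 a k₁ < phiForm δ j / h28 a j)))) *
        (x k₂ - x k₁) := by
  classical
  -- shorthand for the three rate vectors
  obtain ⟨r, hr⟩ : ∃ r : (Fin 8 → ℝ) → Fin 28 → ℝ, ∀ θ k, r θ k = phiForm θ k / h28 a k := ⟨_, fun _ _ => rfl⟩
  simp only [← hr] at htie hsimple hsplit hgen hgen' hlex hlex' ⊢
  have hδ : ∀ k l, r δ k < r δ l → r δ₀ k < r δ₀ l := fun k l h => hlex k l (Or.inl h)
  have hδ' : ∀ k l, r δ k < r δ l → r δ₀' k < r δ₀' l := fun k l h => hlex' k l (Or.inl h)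
  have h12 : r δ₀ k₁ < r δ₀ k₂ := hlex k₁ k₂ (Or.inr ⟨htie, hsplit⟩)
  have h21' : r δ₀' k₂ < r δ₀' k₁ := hlex' k₂ k₁ (Or.inr ⟨htie.symm, hsplit⟩)
  -- every other form is off the tie
  have hoff : ∀ j, j ≠ k₁ → j ≠ k₂ → r δ j ≠ r δ k₁ := fun j hj1 hj2 h => by
    rcases hsimple j k₁ hj1 h with ⟨h1, -⟩ | ⟨h1, -⟩
    · exact hj1 h1
    · exact hj2 h1
  -- the position of every other form relative to the pair is that of `δ`, for both references
  have hpos₁ : ∀ j, j ≠ k₁ → j ≠ k₂ → ∀ θ : Fin 8 → ℝ, (∀ k l, r δ k < r δ l → r θ k < r θ l) →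
      ((r θ k₁ < r θ j ↔ r δ k₁ < r δ j) ∧ (r θ k₂ < r θ j ↔ r δ k₁ < r δ j)) := by
    intro j hj1 hj2 θ hθ
    rcases (hoff j hj1 hj2).lt_or_gt with h | h
    · have h2 : r δ j < r δ k₂ := by rw [← htie]; exact h
      exact ⟨⟨fun h' => absurd ((hθ j k₁ h).trans h') (lt_irrefl _), fun h' => absurd (h.trans h') (lt_irrefl _)⟩,
        ⟨fun h' => absurd ((hθ j k₂ h2).trans h') (lt_irrefl _), fun h' => absurd (h.trans h') (lt_irrefl _)⟩⟩
    · have h2 : r δ k₂ < r δ j := by rw [← htie]; exact h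
      exact ⟨⟨fun _ => h, fun _ => hθ k₁ j h⟩, ⟨fun _ => h, fun _ => hθ k₂ j h2⟩⟩
  have h := greedy_sub_greedy_of_adjacent (M := Finset.univ) F (ρ := fun j => r δ₀' j) (ρ' := fun j => r δ₀ j)
    (fun i _ j _ hij => hgen' i j hij) (fun i _ j _ hij => hgen i j hij) (Finset.mem_univ k₁) (Finset.mem_univ k₂) hne
    h21' h12
    (fun j _ hj => by
      by_cases hj1 : j = k₁
      · subst hj1; exact lt_irrefl _ hj.2
      by_cases hj2 : j = k₂
      · subst hj2; exact lt_irrefl _ hj.1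
      rcases (hoff j hj1 hj2).lt_or_gt with h | h
      · have h2 : r δ j < r δ k₂ := by rw [← htie]; exact h
        exact lt_asymm hj.1 (hδ' j k₂ h2)
      · exact lt_asymm hj.2 (hδ' k₁ j h))
    (fun j _ hj1 hj2 => by
      obtain ⟨h1', h2'⟩ := hpos₁ j hj1 hj2 δ₀' hδ'
      obtain ⟨h1, h2⟩ := hpos₁ j hj1 hj2 δ₀ hδ
      exact ⟨h1'.trans h1.symm, h2'.trans h2.symm⟩)
    (fun i _ j _ hi1 hi2 hj1 hj2 => by
      by_cases hij : i = j
      · subst hij; exact ⟨fun h => absurd h (lt_irrefl _), fun h => absurd h (lt_irrefl _)⟩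
      have hij' : r δ i ≠ r δ j := fun h => by
        rcases hsimple i j hij h with ⟨h1, -⟩ | ⟨h1, -⟩
        · exact hi1 h1
        · exact hi2 h1
      rcases hij'.lt_or_gt with h | h
      · exact ⟨fun _ => hδ i j h, fun _ => hδ' i j h⟩
      · exact ⟨fun h' => absurd ((hδ' j i h).trans h') (lt_irrefl _),
          fun h' => absurd ((hδ j i h).trans h') (lt_irrefl _)⟩)
    x
  beta_reduce at h
  -- the earlier set of `δ₀'` at `k₁` is the set of forms above the tie
  have hS : (Finset.univ.filter fun j => r δ₀' k₁ < r δ₀' j) = Finset.univ.filter fun j => r δ k₁ < r δ j := by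
    refine Finset.filter_congr fun j _ => ?_
    by_cases hj1 : j = k₁
    · subst hj1; exact ⟨fun h => absurd h (lt_irrefl _), fun h => absurd h (lt_irrefl _)⟩
    by_cases hj2 : j = k₂
    · subst hj2
      exact ⟨fun h => absurd (h21'.trans h) (lt_irrefl _), fun h => absurd h (by rw [htie]; exact lt_irrefl _)⟩
    exact (hpos₁ j hj1 hj2 δ₀' hδ').1
  rw [hS] at h
  rw [← h, ← Finset.sum_sub_distrib]
  exact Finset.sum_congr rfl fun k _ => by ring

/-! ### The kink of the cusp slope at a simple tie -/

/-- **THE KINK OF `σ` AT A SIMPLE TIE IS THE POOLED WALL DEFECT TIMES THE SPLITTING.** All 28 forms of `a` positive, `T > 0` a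
period, `F` the canonical period pattern function; `δ` with a simple tie at `{k₁, k₂}`, `Δ` splitting it, `δ₀`, `δ₀'` generic
references refining the lexicographic orders of `(δ, Δ)`, `(δ, −Δ)`. Then there is `t₀ > 0` with
**`σ(δ + t·Δ) + σ(δ − t·Δ) − 2σ(δ) = t·m_F·(r_{k₂}(Δ) − r_{k₁}(Δ))` for all `t ∈ [0, t₀]`**,
`m_F = F(S∪{k₁}) + F(S∪{k₂}) − F(S) − F(S∪{k₁,k₂})`, `S = {j : r_{k₁}(δ) < r_j(δ)}`. -/
theorem cuspSlope_symm_add_smul_eq_of_simple_tie {a : Dir} (hpos : ∀ k, 0 < h28 a k) {T : ℝ} (hT : 0 < T)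
    (hper : ∀ k : Fin 28, ∃ z : ℤ, T * h28 a k = z) {F : Finset (Fin 28) → ℝ}
    (hF : ∀ A, F A = ∑ m ∈ Finset.range ((bkpts a T).card - 1), ((patternN a (bkpt a T m) A : ℤ) : ℝ))
    (δ Δ : Fin 8 → ℝ) {k₁ k₂ : Fin 28} (hne : k₁ ≠ k₂) (htie : phiForm δ k₁ / h28 a k₁ = phiForm δ k₂ / h28 a k₂)
    (hsimple : ∀ i j : Fin 28, i ≠ j → phiForm δ i / h28 a i = phiForm δ j / h28 a j →
      (i = k₁ ∧ j = k₂) ∨ (i = k₂ ∧ j = k₁))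
    (hsplit : phiForm Δ k₁ / h28 a k₁ < phiForm Δ k₂ / h28 a k₂) {δ₀ δ₀' : Fin 8 → ℝ}
    (hgen : ∀ k l : Fin 28, k ≠ l → phiForm δ₀ k / h28 a k ≠ phiForm δ₀ l / h28 a l)
    (hgen' : ∀ k l : Fin 28, k ≠ l → phiForm δ₀' k / h28 a k ≠ phiForm δ₀' l / h28 a l)
    (hlex : ∀ k l : Fin 28, (phiForm δ k / h28 a k < phiForm δ l / h28 a l ∨
        (phiForm δ k / h28 a k = phiForm δ l / h28 a l ∧ phiForm Δ k / h28 a k < phiForm Δ l / h28 a l)) →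
      phiForm δ₀ k / h28 a k < phiForm δ₀ l / h28 a l)
    (hlex' : ∀ k l : Fin 28, (phiForm δ k / h28 a k < phiForm δ l / h28 a l ∨
        (phiForm δ k / h28 a k = phiForm δ l / h28 a l ∧ phiForm Δ l / h28 a l < phiForm Δ k / h28 a k)) →
      phiForm δ₀' k / h28 a k < phiForm δ₀' l / h28 a l) :
    ∃ t₀ : ℝ, 0 < t₀ ∧ ∀ t ∈ Icc (0 : ℝ) t₀,
      cuspSlope a T (δ + t • Δ) + cuspSlope a T (δ - t • Δ) - 2 * cuspSlope a T δ =
        t * ((F (insert k₁ (Finset.univ.filter fun j => phiForm δ k₁ / h28 a k₁ < phiForm δ j / h28 a j)) +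
            F (insert k₂ (Finset.univ.filter fun j => phiForm δ k₁ / h28 a k₁ < phiForm δ j / h28 a j)) -
            F (Finset.univ.filter fun j => phiForm δ k₁ / h28 a k₁ < phiForm δ j / h28 a j) -
            F (insert k₁ (insert k₂ (Finset.univ.filter fun j => phiForm δ k₁ / h28 a k₁ < phiForm δ j / h28 a j)))) *
          (phiForm Δ k₂ / h28 a k₂ - phiForm Δ k₁ / h28 a k₁)) := by
  obtain ⟨t₀, ht₀, h⟩ := cuspSlope_symm_add_smul_eq_of_lex hpos hT hper hF δ Δ hgen hgen' hlex hlex'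
  refine ⟨t₀, ht₀, fun t ht => ?_⟩
  rw [h t ht, lex_functional_sub_of_simple_tie F δ Δ hne htie hsimple hsplit hgen hgen' hlex hlex']

/-- **The canonical period pattern function is INTEGER-valued.** -/
theorem canonical_value_int {a : Dir} {T : ℝ} {F : Finset (Fin 28) → ℝ}
    (hF : ∀ A, F A = ∑ m ∈ Finset.range ((bkpts a T).card - 1), ((patternN a (bkpt a T m) A : ℤ) : ℝ))
    (A : Finset (Fin 28)) : ∃ z : ℤ, F A = z :=
  ⟨∑ m ∈ Finset.range ((bkpts a T).card - 1), patternN a (bkpt a T m) A, by rw [hF]; push_cast; rfl⟩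

open scoped Classical in
/-- **THE KINK OF `σ` AT A SIMPLE TIE — reference-free, with the junction count.** All 28 forms of `a` positive, `T > 0` a
period, `F` the canonical period pattern function. For EVERY displacement `δ` with a simple tie at `{k₁, k₂}` and EVERY `Δ`
splitting it there are an INTEGER `m` — the pooled wall defect `m_F(S; k₁, k₂)`, `S = {j : r_{k₁}(δ) < r_j(δ)}` — with
**`|m| ≤ #{m' < #bkpts − 1 : b_{m'}·h_{k₁}(a) ∈ ℤ ∧ b_{m'}·h_{k₂}(a) ∈ ℤ}`** (the number of junctions of the period on the wall
`{k₁, k₂}`) and `t₀ > 0` such that **`σ(δ + t·Δ) + σ(δ − t·Δ) − 2σ(δ) = t·m·(r_{k₂}(Δ) − r_{k₁}(Δ))` on `[0, t₀]`**. -/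
theorem cuspSlope_kink_of_simple_tie {a : Dir} (hpos : ∀ k, 0 < h28 a k) {T : ℝ} (hT : 0 < T)
    (hper : ∀ k : Fin 28, ∃ z : ℤ, T * h28 a k = z) {F : Finset (Fin 28) → ℝ}
    (hF : ∀ A, F A = ∑ m ∈ Finset.range ((bkpts a T).card - 1), ((patternN a (bkpt a T m) A : ℤ) : ℝ))
    (δ Δ : Fin 8 → ℝ) {k₁ k₂ : Fin 28} (hne : k₁ ≠ k₂) (htie : phiForm δ k₁ / h28 a k₁ = phiForm δ k₂ / h28 a k₂)
    (hsimple : ∀ i j : Fin 28, i ≠ j → phiForm δ i / h28 a i = phiForm δ j / h28 a j →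
      (i = k₁ ∧ j = k₂) ∨ (i = k₂ ∧ j = k₁))
    (hsplit : phiForm Δ k₁ / h28 a k₁ < phiForm Δ k₂ / h28 a k₂) :
    ∃ m : ℤ, (m : ℝ) =
        F (insert k₁ (Finset.univ.filter fun j => phiForm δ k₁ / h28 a k₁ < phiForm δ j / h28 a j)) +
          F (insert k₂ (Finset.univ.filter fun j => phiForm δ k₁ / h28 a k₁ < phiForm δ j / h28 a j)) -
          F (Finset.univ.filter fun j => phiForm δ k₁ / h28 a k₁ < phiForm δ j / h28 a j) -
          F (insert k₁ (insert k₂ (Finset.univ.filter fun j => phiForm δ k₁ / h28 a k₁ < phiForm δ j / h28 a j))) ∧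
      |(m : ℝ)| ≤ (((Finset.range ((bkpts a T).card - 1)).filter fun m' =>
        (∃ z : ℤ, bkpt a T m' * h28 a k₁ = z) ∧ ∃ z : ℤ, bkpt a T m' * h28 a k₂ = z).card : ℝ) ∧
      ∃ t₀ : ℝ, 0 < t₀ ∧ ∀ t ∈ Icc (0 : ℝ) t₀,
        cuspSlope a T (δ + t • Δ) + cuspSlope a T (δ - t • Δ) - 2 * cuspSlope a T δ =
          t * ((m : ℝ) * (phiForm Δ k₂ / h28 a k₂ - phiForm Δ k₁ / h28 a k₁)) := by
  obtain ⟨δ₀, hgen, hlex⟩ := exists_generic_refines_lex hpos δ Δ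
  obtain ⟨δ₀', hgen', hlex₀⟩ := exists_generic_refines_lex hpos δ (-Δ)
  have hneg : ∀ k, phiForm (-Δ) k / h28 a k = -(phiForm Δ k / h28 a k) := fun k => by
    rw [phiForm_neg, neg_div]
  have hlex' : ∀ k l : Fin 28, (phiForm δ k / h28 a k < phiForm δ l / h28 a l ∨
      (phiForm δ k / h28 a k = phiForm δ l / h28 a l ∧ phiForm Δ l / h28 a l < phiForm Δ k / h28 a k)) →
        phiForm δ₀' k / h28 a k < phiForm δ₀' l / h28 a l := by
    intro k l h
    refine hlex₀ k l (h.imp_right fun h' => ⟨h'.1, ?_⟩)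
    rw [hneg, hneg, neg_lt_neg_iff]
    exact h'.2
  obtain ⟨t₀, ht₀, h⟩ :=
    cuspSlope_symm_add_smul_eq_of_simple_tie hpos hT hper hF δ Δ hne htie hsimple hsplit hgen hgen' hlex hlex'
  -- the defect is an integer
  set S := Finset.univ.filter fun j => phiForm δ k₁ / h28 a k₁ < phiForm δ j / h28 a j with hS
  obtain ⟨z₁, hz₁⟩ := canonical_value_int hF (insert k₁ S)
  obtain ⟨z₂, hz₂⟩ := canonical_value_int hF (insert k₂ S)
  obtain ⟨z₃, hz₃⟩ := canonical_value_int hF S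
  obtain ⟨z₄, hz₄⟩ := canonical_value_int hF (insert k₁ (insert k₂ S))
  have hk₁S : k₁ ∉ S := by rw [hS, Finset.mem_filter]; exact fun h => lt_irrefl _ h.2
  have hbound := canonical_defect_abs_le_junctionCount hF hk₁S hne
  refine ⟨z₁ + z₂ - z₃ - z₄, by push_cast; rw [hz₁, hz₂, hz₃, hz₄], ?_, t₀, ht₀, fun t ht => ?_⟩
  · push_cast
    rw [← hz₁, ← hz₂, ← hz₃, ← hz₄]
    exact hbound
  · rw [h t ht]
    push_cast
    rw [← hz₁, ← hz₂, ← hz₃, ← hz₄]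

end Summit.KontsevichZagierPeriods.Zeta5Search.Barrier.ConeGamma

end
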